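import Mathlib
import HarnessLib
import Summits.NavierStokesRegularity.NavierStokesRegularity.Theorems.PoloidalWindowDoorPoloidalWindowRigidityWindow
import Summits.NavierStokesRegularity.NavierStokesRegularity.Theorems.AdaptedFrequencyTangentFlowTransferAncientPressure
import Summits.NavierStokesRegularity.NavierStokesRegularity.Theorems.RellichScarSymmetricScarExistsTypeITimeDerivDecay

/-!
# nsreg-p1 ROUND-15 (planned doors S16 / S16′ / S16γ), support `ProfileGradientDecay`: scale-invariant derivative
# decay of door-class profiles with SPACE–TIME Type-I decay

The door class of the cell's one-window doors (Type I in time `‖v(t,x)‖ ≤ C/√(−t)`, continuous on the open backward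
slab, unit-viscosity Oseen–Duhamel identity between negative times, divergence-free slices) lies in the tree's
`IsTypeIAncientMild` (`isTypeIAncientMild_of_class`, joint analyticity), hence is CLASSICAL on `(−∞,0) × ℝ³` for
one smooth pressure (`exists_isClassicalNSSolutionOn_Iio_of_isTypeIAncientMild`).  Under the additional SPACE–TIME
Type-I decay `‖v(t,x)‖ ≤ D/(‖x‖+√(−t))` the tree's Seregin–Šverák / Pineau–Vicol bootstrap
(`exists_weight_pow_mul_norm_iteratedFDeriv_le`) and the apex scale-invariant bounds of the RellichScar chain
(`stub_apexScaleInvariantBounds_ofTimeDerivDecay stub_typeITimeDerivDecay`: pressure re-identified as the Riesz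
pressure, time derivative) give, with ONE constant `K = K(D)`:

* `exists_classical_scaleInvariantBounds` — a pressure `q` with `(v,q)` classical on `(−∞,0)` and
  `r‖v‖, r²‖Dv‖, r³‖D²v‖, r⁴‖D³v‖, r²|q|, r³‖∇q‖, r³‖∂ₜv‖, r⁴‖D∂ₜv‖ ≤ K`, `r = ‖x‖ + √(−t)`;
* `profileGradientDecay` — the TEXT of nsreg-p1 r15/Sketch16.lean `ProfileGradientDecay` (orders `n ≤ 3`).

These bounds make the PROFILE ENSTROPHY `∫|∇v(s)|²_F ≲ K²(−s)^{−1/2}` finite and justify the enstrophy balance on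
every window — the analytic input of the three profile Liouville theorems (`PlaneStrainDoorProfileEnstrophy*`).
Seat nsreg-p6 g8.  WHAT THIS IS NOT: not NS regularity — regularity bookkeeping for a CONDITIONAL door's profile
class; not a route open.
-/

noncomputable section

open MeasureTheory Set Function Filter Topology InnerProductSpace
open scoped ENNReal NNReal RealInnerProductSpace
open Literature.Analysis Literature.Analysis.FluidPDE
open Summit.NavierStokesRegularity.NavierStokesRegularity.Theorems.PoloidalWindowDoorPoloidalWindowRigidityWindow
open Summit.NavierStokesRegularity.NavierStokesRegularity.Theorems.SymmetricScarExists.LogtimeBernoulli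

-- the summit and its single sub-problem share the name (CONVENTIONS §1), as in every Theorems file
set_option linter.dupNamespace false

namespace Summit.NavierStokesRegularity.NavierStokesRegularity.Theorems.PlaneStrainDoorProfileGradientDecay

variable {C D : ℝ} {v : ℝ → EuclideanSpace ℝ (Fin 3) → EuclideanSpace ℝ (Fin 3)}

/-- **A door-class profile is classical on the past.** -/
theorem exists_classical (hrate : HasTypeITimeDecay C v)
    (hcont : ContinuousOn (uncurry v) (Iio (0 : ℝ) ×ˢ univ))
    (hmild : ∀ s t : ℝ, s < t → t < 0 → ∀ x,
      v t x = UnboundedOperators.heatExtension (v s) (t - s) x - oseenDuhamel 1 s v v t x)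
    (hdiv : ∀ t < 0, VectorCalculus.IsDivFree (v t)) :
    ∃ q : ℝ → EuclideanSpace ℝ (Fin 3) → ℝ, IsClassicalNSSolutionOn (Iio 0) 1 0 v q :=
  exists_isClassicalNSSolutionOn_Iio_of_isTypeIAncientMild (isTypeIAncientMild_of_class hrate hcont hmild hdiv)

/-- **Scale-invariant bounds of a door-class profile with space–time Type-I decay** (one constant `K` for the
velocity up to third spatial order, a re-identified classical pressure, and the time derivative). -/
theorem exists_classical_scaleInvariantBounds (hrate : HasTypeITimeDecay C v) (hdec : HasTypeIDecay D v)
    (hcont : ContinuousOn (uncurry v) (Iio (0 : ℝ) ×ˢ univ))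
    (hmild : ∀ s t : ℝ, s < t → t < 0 → ∀ x,
      v t x = UnboundedOperators.heatExtension (v s) (t - s) x - oseenDuhamel 1 s v v t x)
    (hdiv : ∀ t < 0, VectorCalculus.IsDivFree (v t)) :
    ∃ (q : ℝ → EuclideanSpace ℝ (Fin 3) → ℝ) (K : ℝ), IsClassicalNSSolutionOn (Iio 0) 1 0 v q ∧ 0 ≤ K ∧
      ∀ t < (0 : ℝ), ∀ x : EuclideanSpace ℝ (Fin 3),
        (‖x‖ + Real.sqrt (-t)) * ‖v t x‖ ≤ K ∧
        (‖x‖ + Real.sqrt (-t)) ^ 2 * ‖fderiv ℝ (v t) x‖ ≤ K ∧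
        (‖x‖ + Real.sqrt (-t)) ^ 3 * ‖iteratedFDeriv ℝ 2 (v t) x‖ ≤ K ∧
        (‖x‖ + Real.sqrt (-t)) ^ 4 * ‖iteratedFDeriv ℝ 3 (v t) x‖ ≤ K ∧
        (‖x‖ + Real.sqrt (-t)) ^ 2 * |q t x| ≤ K ∧
        (‖x‖ + Real.sqrt (-t)) ^ 3 * ‖gradient (q t) x‖ ≤ K ∧
        (‖x‖ + Real.sqrt (-t)) ^ 3 * ‖timeDeriv v t x‖ ≤ K ∧
        (‖x‖ + Real.sqrt (-t)) ^ 4 * ‖fderiv ℝ (timeDeriv v t) x‖ ≤ K := by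
  obtain ⟨q₀, hcl₀⟩ := exists_classical hrate hcont hmild hdiv
  obtain ⟨q, K₁, hcl, hK₁⟩ :=
    stub_apexScaleInvariantBounds_ofTimeDerivDecay stub_typeITimeDerivDecay v q₀ D hcl₀ hdec
  obtain ⟨K₃, hK₃0, hK₃⟩ := exists_weight_pow_mul_norm_iteratedFDeriv_le 3 D
  have hD : 0 ≤ D := typeI_const_nonneg hdec
  have hK₁0 : 0 ≤ K₁ := by
    have h := (hK₁ (-1) (by norm_num) 0).1
    exact le_trans (mul_nonneg (sq_nonneg _) (norm_nonneg _)) h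
  refine ⟨q, max D (max K₁ K₃), hcl, le_max_of_le_left hD, fun t ht x => ?_⟩
  obtain ⟨h1, h2, h3, h4, h5, h6⟩ := hK₁ t ht x
  have h0 : (‖x‖ + Real.sqrt (-t)) * ‖v t x‖ ≤ D := weight_mul_norm_le_of_hasTypeIDecay hdec ht x
  have h7 := hK₃ v q hcl hdec t ht x
  refine ⟨h0.trans (le_max_left _ _), h1.trans ?_, h2.trans ?_, h7.trans ?_, h3.trans ?_, h4.trans ?_,
    h5.trans ?_, h6.trans ?_⟩
  all_goals simp only [le_max_iff, le_refl, true_or, or_true]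

/-- **support `ProfileGradientDecay`** (text of nsreg-p1 `r15/Sketch16.lean`, verbatim): scale-invariant decay of all
spatial derivatives of order `≤ 3` of a door-class profile with space–time Type-I decay,
`‖Dⁿv(s,y)‖ ≤ L/(‖y‖+√(−s))^{n+1}`. -/
theorem profileGradientDecay :
    ∀ (C D : ℝ) (v : ℝ → EuclideanSpace ℝ (Fin 3) → EuclideanSpace ℝ (Fin 3)),
    HasTypeITimeDecay C v →
    HasTypeIDecay D v →
    ContinuousOn (Function.uncurry v) (Set.Iio (0 : ℝ) ×ˢ Set.univ) →
    (∀ s t : ℝ, s < t → t < 0 → ∀ x, v t x =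
      UnboundedOperators.heatExtension (v s) (t - s) x - oseenDuhamel 1 s v v t x) →
    (∀ t < 0, VectorCalculus.IsDivFree (v t)) →
    ∃ L : ℝ, ∀ s < 0, ∀ y : EuclideanSpace ℝ (Fin 3), ∀ n ≤ 3,
      ‖iteratedFDeriv ℝ n (v s) y‖ ≤ L / (‖y‖ + Real.sqrt (-s)) ^ (n + 1) := by
  intro C D v hrate hdec hcont hmild hdiv
  obtain ⟨q, hcl⟩ := exists_classical hrate hcont hmild hdiv
  obtain ⟨K₀, -, hK₀⟩ := exists_weight_pow_mul_norm_iteratedFDeriv_le 0 D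
  obtain ⟨K₁, -, hK₁⟩ := exists_weight_pow_mul_norm_iteratedFDeriv_le 1 D
  obtain ⟨K₂, -, hK₂⟩ := exists_weight_pow_mul_norm_iteratedFDeriv_le 2 D
  obtain ⟨K₃, -, hK₃⟩ := exists_weight_pow_mul_norm_iteratedFDeriv_le 3 D
  refine ⟨max (max K₀ K₁) (max K₂ K₃), fun s hs y n hn => ?_⟩
  have hr : 0 < ‖y‖ + Real.sqrt (-s) :=
    add_pos_of_nonneg_of_pos (norm_nonneg _) (Real.sqrt_pos.2 (by linarith))
  rw [le_div_iff₀ (pow_pos hr _), mul_comm]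
  interval_cases n
  · exact (hK₀ v q hcl hdec s hs y).trans (le_max_of_le_left (le_max_left _ _))
  · exact (hK₁ v q hcl hdec s hs y).trans (le_max_of_le_left (le_max_right _ _))
  · exact (hK₂ v q hcl hdec s hs y).trans (le_max_of_le_right (le_max_left _ _))
  · exact (hK₃ v q hcl hdec s hs y).trans (le_max_of_le_right (le_max_right _ _))

end Summit.NavierStokesRegularity.NavierStokesRegularity.Theorems.PlaneStrainDoorProfileGradientDecay

end
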